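import Summits.ResolutionOfSingularities.ResolutionOfSingularities.Theses.RisoStrata

/-!
# Crux `RisoCentresResolve` (stmt-ResolutionOfSingularities-18546) — negative lemma "bounded letters are
# not enough", part 1/4: Hahn-series valuation helpers

Support file of `RisoCentresResolveFalseWithBoundedLetters` (route `ResolutionOfSingularities/RisoStrata`,
crux `RisoCentresResolve`): order estimates for evaluating multivariate polynomials at Hahn series
`k⟦t^ℚ⟧` — nonnegative order is preserved, polynomials without constant term go to positive order, and
the consequence used by the typed riso-triviality construction: an algebra map that sends a generating
tuple to series of positive order sends the whole maximal ideal through that tuple to series of positive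
order.  No definitions; kernel-only.
-/

set_option linter.dupNamespace false

namespace Summit.ResolutionOfSingularities.ResolutionOfSingularities.Theorems

open Polynomial

section HahnHelpers

variable {k : Type} [Field k] {σ : Type}

/-- Evaluating a polynomial at Hahn series of nonnegative order gives nonnegative order. [folklore] -/
theorem bddLetters_orderTop_aeval_nonneg (u : σ → HahnSeries ℚ k) (hu : ∀ i, 0 ≤ (u i).orderTop)
    (q : MvPolynomial σ k) : 0 ≤ (MvPolynomial.aeval u q).orderTop := by
  induction q using MvPolynomial.induction_on with
  | C c =>
    rw [MvPolynomial.algHom_C]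
    have hC : algebraMap k (HahnSeries ℚ k) c = HahnSeries.C c := by
      first
      | rfl
      | (rw [HahnSeries.algebraMap_apply']; simp)
    rw [hC, HahnSeries.C_apply]
    exact HahnSeries.orderTop_single_le
  | add p q hp hq =>
    rw [map_add]
    exact (le_min hp hq).trans HahnSeries.min_orderTop_le_orderTop_add
  | mul_X p i hp =>
    rw [map_mul, MvPolynomial.aeval_X]
    exact (add_nonneg hp (hu i)).trans HahnSeries.orderTop_add_le_mul

/-- Evaluating a polynomial WITHOUT CONSTANT TERM at Hahn series of positive order gives positive
order. [folklore] -/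
theorem bddLetters_orderTop_aeval_pos (u : σ → HahnSeries ℚ k) (hu : ∀ i, 0 < (u i).orderTop)
    (q : MvPolynomial σ k) (hq : MvPolynomial.constantCoeff q = 0) :
    0 < (MvPolynomial.aeval u q).orderTop := by
  classical
  have hmem : q ∈ Ideal.span (MvPolynomial.X '' (Set.univ : Set σ)) := by
    rw [MvPolynomial.mem_ideal_span_X_image]
    intro mo hmo
    by_contra hcon
    push Not at hcon
    have hmo0 : mo = 0 := Finsupp.ext fun i => by simpa using hcon i (Set.mem_univ i)
    rw [hmo0, MvPolynomial.mem_support_iff] at hmo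
    exact hmo (by rwa [← MvPolynomial.constantCoeff_eq] )
  clear hq
  induction hmem using Submodule.span_induction with
  | mem x hx =>
    obtain ⟨i, -, rfl⟩ := hx
    rw [MvPolynomial.aeval_X]; exact hu i
  | zero => rw [map_zero, HahnSeries.orderTop_zero]; exact WithTop.coe_lt_top _
  | add x y _ _ hx hy =>
    rw [map_add]
    exact (lt_min hx hy).trans_le HahnSeries.min_orderTop_le_orderTop_add
  | smul r x _ hx =>
    rw [smul_eq_mul, map_mul]
    have h0 : (0 : WithTop ℚ) ≤ (MvPolynomial.aeval u r).orderTop :=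
      bddLetters_orderTop_aeval_nonneg u (fun i => (hu i).le) r
    have h1 : (MvPolynomial.aeval u x).orderTop ≤
        (MvPolynomial.aeval u r).orderTop + (MvPolynomial.aeval u x).orderTop := by
      simpa only [zero_add] using add_le_add h0 (le_refl (MvPolynomial.aeval u x).orderTop)
    exact (hx.trans_le h1).trans_le HahnSeries.orderTop_add_le_mul

/-- If `g` generates the `k`-algebra `B`, `ε : B → k` kills the `g i`, and `γ : B → k⟦t^ℚ⟧` sends the
`g i` to series of positive order, then `γ` sends `ker ε` to series of positive order. [folklore] -/
theorem bddLetters_orderTop_pos_of_ker {B : Type} [CommRing B] [Algebra k B] (g : σ → B)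
    (hsurj : Function.Surjective (MvPolynomial.aeval g : MvPolynomial σ k →ₐ[k] B))
    (ε : B →ₐ[k] k) (hε : ∀ i, ε (g i) = 0) (γ : B →ₐ[k] HahnSeries ℚ k)
    (hγ : ∀ i, 0 < (γ (g i)).orderTop) (b : B) (hb : ε b = 0) : 0 < (γ b).orderTop := by
  obtain ⟨q, rfl⟩ := hsurj b
  have hc : MvPolynomial.constantCoeff q = 0 := by
    have h1 : ε (MvPolynomial.aeval g q) = MvPolynomial.aeval (fun i => ε (g i)) q := by
      rw [← AlgHom.comp_apply, MvPolynomial.comp_aeval]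
    have h0 : (fun i => ε (g i)) = (0 : σ → k) := funext hε
    rw [hb, h0, MvPolynomial.aeval_zero] at h1
    have h2 := h1.symm
    simpa using h2
  rw [← AlgHom.comp_apply, MvPolynomial.comp_aeval]
  exact bddLetters_orderTop_aeval_pos _ hγ q hc

end HahnHelpers

end Summit.ResolutionOfSingularities.ResolutionOfSingularities.Theorems
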